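import Mathlib
import Summits.NavierStokesRegularity.NavierStokesRegularity.Theorems.EulerZoomLiouvillePowerGaugeEulerLiouvilleSelfSimilarSwirlPiercingVortical
import Summits.NavierStokesRegularity.NavierStokesRegularity.Theorems.EulerZoomLiouvillePowerGaugeEulerLiouvilleSelfSimilarSwirlHardy
import Summits.NavierStokesRegularity.NavierStokesRegularity.Theorems.EulerZoomLiouvillePowerGaugeEulerLiouvilleSelfSimilarSwirlPowerLaw
import HarnessLib

/-!
# Crux E `PowerGaugeEulerLiouville` (stmt-NavierStokesRegularity-19832), THE ONE STATEMENT, residue (N4′): THE PORTRAIT OF THE SWIRLING AXISYMMETRIC NEEDLE in ONE theorem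
# (T1 dossier for the next hand; width seat ns-ezl-w3 g3)

Route №10 `EulerZoomLiouville` (NavierStokesRegularity), crux E; LEAD ns-typeII-p2 g12; target T1 of RESIDUE-MEMO §2 (`Loc.selfSimilar_ae_eq_zero_of_axisymC2_profile`, swirl
allowed).  `axisymNeedle_portrait` bundles, for an exactly self-similar member of the class (crux binders VERBATIM, `0 < ρ ≤ ½`) with an axisymmetric `C²` profile `V` of linear
growth that is NOT swirl-free — i.e. exactly the object T1 must kill — everything the lane has proved about it, with ONE classical pressure `P′` of the profile:

* (P1, POWER LAW) `vol{μ < |Γ|} = μ^{−3/ρ} · K` for all `μ > 0`, `K = vol{1 < |Γ|}`, and `K ≠ 0` (`…SwirlPowerLaw`, (C3)/(C5); `Γ = swirl V = rV_θ`);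
* (P2, PIERCING) beyond some radius every sphere `S_R` carries a VORTICAL STRICT-INFLOW point `a` (`curl V a ≠ 0`, `⟪a, γa + V a⟫ < 0`, `⟪a, V a⟫ < −γR²`, `γR < ‖V a‖`) at which
  `|Γ|` is maximal over the ball `‖y‖ ≤ R` (`…SwirlPiercing[Vortical]`);
* (P3, `A`-SMALLNESS IN BALLS) `ofReal(μ²/L²)·vol({μ < |Γ|} ∩ B_L) ≤ c·L^{1−2ρ}` for all `L, μ > 0` (`…SwirlPowerLaw`);
* (P4, `E`-HARDY) `∫⁻ ofReal(Γ²/r⁴ · ‖y‖^{ρ−1}) ≤ ofReal((1−ρ)/(2+ρ))·c` (`…SwirlHardy`).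

(The swirl set lies in the vortical set, `SwirlRatchet.curl_ne_zero_of_swirl_ne_zero`; the rate law at swirl maxima is `SwirlRatchet.swirlMax_inflow_rate`.)  What T1 still
needs (RESIDUE-MEMO §2): an estimate coupling the backward growth `Γ(Y t) = e^{ργt}Γ(y)` to `ℋ` or to (P4) along the thin inflow channels of (P2)/(P3).
WHAT THIS IS NOT: not NS regularity, not the crux E, not a kill — the dossier of the registered residue of the crux CLASS 19832 (MODEL lattice; E/NS strata),
`--supports` stmt-19832; 19832 OPEN. [cite: Chae2007CMPEuler, Thm 2.2 + Note added p. 6; CaffarelliKohnNirenberg1982 §2; MajdaBertozziCUP2002 §2.3.3]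
-/

noncomputable section

-- flat `Theorems/<Route><Decl>…` files of one crux share the namespace of the crux (tree convention: `Summit.<S>.<S>.…`)
set_option linter.dupNamespace false

open MeasureTheory Set Filter Topology Metric Function InnerProductSpace
open scoped RealInnerProductSpace NNReal ENNReal ContDiff

namespace Summit.NavierStokesRegularity.NavierStokesRegularity.Theorems.PowerGaugeEulerLiouville

open Literature.Analysis Literature.Analysis.FluidPDE Literature.Analysis.FunctionSpaces

namespace SwirlRatchet

variable {u : ℝ → EuclideanSpace ℝ (Fin 3) → EuclideanSpace ℝ (Fin 3)} {p : ℝ → EuclideanSpace ℝ (Fin 3) → ℝ}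
  {H : ℝ → EuclideanSpace ℝ (Fin 3) → EuclideanSpace ℝ (Fin 3) →L[ℝ] EuclideanSpace ℝ (Fin 3)} {c : ℝ≥0}
  {V : EuclideanSpace ℝ (Fin 3) → EuclideanSpace ℝ (Fin 3)} {P : EuclideanSpace ℝ (Fin 3) → ℝ}

/-- **THE PORTRAIT OF THE SWIRLING AXISYMMETRIC NEEDLE (T1 dossier).**  Crux binders verbatim (`0 < ρ ≤ ½`), exactly self-similar member about the origin, axisymmetric `C²`
profile of linear growth with swirl somewhere ⇒ there is a classical pressure `P′` (CIV (3.3)) and: (P1) the exact power law of the swirl distribution with `K = vol{1<|Γ|} ≠ 0`;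
(P2) vortical strict-inflow swirl maxima on every sphere beyond some radius; (P3) `A`-smallness of the swirl superlevel sets in balls; (P4) the `E`-Hardy swirl bound.
[cite: Chae2007CMPEuler, Thm 2.2 + Note added p. 6; CaffarelliKohnNirenberg1982 §2] -/
theorem axisymNeedle_portrait {ρ : ℝ} (hρ : 0 < ρ) (hρ1 : ρ ≤ 1 / 2)
    (hsw : IsSuitableWeakSolutionOn (slab (EuclideanSpace ℝ (Fin 3)) (Iio 0) isOpen_Iio) 0 0 u p)
    (hH : HasWeakSpatialGradientOn (slab (EuclideanSpace ℝ (Fin 3)) (Iio 0) isOpen_Iio) u H)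
    (hgauge : ∀ a : ℝ, 0 < a →
      ENNReal.ofReal (a ^ (2 * ρ)) * cknA a (0 : ℝ × EuclideanSpace ℝ (Fin 3)) u +
          ENNReal.ofReal (a ^ ρ) * cknE a (0 : ℝ × EuclideanSpace ℝ (Fin 3)) H +
        ENNReal.ofReal (a ^ (2 * ρ)) * cknD a (0 : ℝ × EuclideanSpace ℝ (Fin 3)) p ≤ (c : ENNReal))
    (hu : ∀ τ : ℝ, τ < 0 → u τ = selfSimilarCollapse (1 / (2 + ρ)) 0 V τ)
    (hp : ∀ τ : ℝ, τ < 0 → p τ = selfSimilarCollapsePressure (1 / (2 + ρ)) 0 P τ)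
    (hV : ContDiff ℝ 2 V) (hax : IsAxisymmetric V)
    (hlin : ∃ K₁ : ℝ, ∀ y, ‖V y‖ ≤ K₁ * (1 + ‖y‖)) (hswirl : ¬ HasNoSwirl V) :
    ∃ P' : EuclideanSpace ℝ (Fin 3) → ℝ, IsSelfSimilarEulerProfile (1 / (2 + ρ)) 0 V P' ∧
      -- (P1) power law, non-trivial
      (∀ μ : ℝ, 0 < μ → volume {y : EuclideanSpace ℝ (Fin 3) | μ < |swirl V y|} =
        ENNReal.ofReal (μ ^ (-(3 / ρ))) * volume {y : EuclideanSpace ℝ (Fin 3) | 1 < |swirl V y|}) ∧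
      volume {y : EuclideanSpace ℝ (Fin 3) | 1 < |swirl V y|} ≠ 0 ∧
      -- (P2) vortical strict-inflow swirl maxima on all large spheres
      (∃ R₁ : ℝ, ∀ R : ℝ, R₁ ≤ R → ∃ a : EuclideanSpace ℝ (Fin 3), ‖a‖ = R ∧ swirl V a ≠ 0 ∧ curl V a ≠ 0 ∧
        (∀ y ∈ closedBall (0 : EuclideanSpace ℝ (Fin 3)) R, |swirl V y| ≤ |swirl V a|) ∧
        ⟪a, selfSimilarTransport (1 / (2 + ρ)) 0 V a⟫ < 0 ∧ ⟪a, V a⟫ < -(1 / (2 + ρ) * R ^ 2) ∧ 1 / (2 + ρ) * R < ‖V a‖) ∧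
      -- (P3) `A`-smallness in balls
      (∀ L μ : ℝ, 0 < L → 0 < μ →
        ENNReal.ofReal (μ ^ 2 / L ^ 2) * volume ({y : EuclideanSpace ℝ (Fin 3) | μ < |swirl V y|} ∩ ball 0 L) ≤
          (c : ℝ≥0∞) * ENNReal.ofReal (L ^ (1 - 2 * ρ))) ∧
      -- (P4) `E`-Hardy
      ∫⁻ y, ENNReal.ofReal (swirl V y ^ 2 / cylRadius y ^ 4 * ‖y‖ ^ (ρ - 1)) ≤ ENNReal.ofReal ((1 - ρ) / (2 + ρ)) * (c : ℝ≥0∞) := by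
  obtain ⟨K₁, hK₁⟩ := hlin
  have hρ1' : ρ < 1 := by linarith
  have h2ρ : (0 : ℝ) < 2 + ρ := by linarith
  have hγ0 : (0 : ℝ) ≤ 1 / (2 + ρ) := by positivity
  have hγ2 : 1 / (2 + ρ) < 1 / 2 := one_div_lt_one_div_of_lt two_pos (by linarith)
  -- a classical pressure of the profile (boilerplate of the lineage's member theorems)
  have hD : ∀ a : ℝ, 0 < a → ENNReal.ofReal (a ^ (2 * ρ)) *
      cknD a (0 : ℝ × EuclideanSpace ℝ (Fin 3)) p ≤ (c : ENNReal) :=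
    fun a ha => le_trans le_add_self (hgauge a ha)
  have hpm : AEStronglyMeasurable (uncurry p)
      (volume.restrict (Iio (0 : ℝ) ×ˢ (univ : Set (EuclideanSpace ℝ (Fin 3))))) := by
    have := hsw.distributional.2.2.1.aestronglyMeasurable
    simpa [slab] using this
  have hPm := aestronglyMeasurable_pressureProfile hpm hp
  have hDprof := profile_pressure_weight_of_gaugeD hρ hρ1' hpm hp hD
  have hP1 : LocallyIntegrable P volume :=
    EnergySaturation.locallyIntegrable_pressure_of_weight hρ1' hPm
      (ENNReal.mul_ne_top ENNReal.ofReal_ne_top ENNReal.coe_ne_top) hDprof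
  obtain ⟨P', hprof⟩ := WeakToClassical.exists_isSelfSimilarEulerProfile_of_contDiff hsw.distributional hu hp hV hP1
  refine ⟨P', hprof, fun μ hμ => volume_superlevel_swirl_powerlaw_class hρ hprof hax hK₁ hμ, ?_,
    swirl_piercing_vortical hprof hax hγ0 hγ2 hswirl,
    fun L μ hL hμ => volume_superlevel_swirl_inter_ball_le hρ hρ1' hsw hH hgauge hu hp hV.continuous hL hμ,
    lintegral_sq_swirl_hardy_le hρ hρ1' hsw hH hgauge hu hp hV hax⟩
  -- (P1) `K ≠ 0`: otherwise every superlevel set is null and the profile is swirl-free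
  intro hK
  apply hswirl
  refine hasNoSwirl_of_null_superlevels hV.continuous fun μ hμ => ?_
  rw [volume_superlevel_swirl_powerlaw_class hρ hprof hax hK₁ hμ, hK, mul_zero]

end SwirlRatchet

end Summit.NavierStokesRegularity.NavierStokesRegularity.Theorems.PowerGaugeEulerLiouville

end
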